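import Literature.MathematicalPhysics.QuantumLattice.DysonOrderedIntegral
import Mathlib.MeasureTheory.Integral.DominatedConvergence
import HarnessLib

/-!
# Ordered (simplex) integrals: the crude bound and dominated convergence

Topic `MathematicalPhysics/QuantumLattice`; two elementary facts about the iterated integrals over
the ordered simplex `orderedIntegral k F t = ∫₀ᵗ du_{k-1} ∫₀^{u_{k-1}} ⋯ ∫₀^{u₁} du₀ F(u)` of
`DysonOrderedIntegral.lean` (the shape of the Dyson / perturbative coefficients, e.g. the truncated
coefficients `t_j(L) = (-β)^j ∫_{Δ_j} Σ_x 𝓔ᵀ_j` of `HubbardLinkedCluster.lean`), used to pass to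
the limit INSIDE a coefficient of fixed order:

* `norm_orderedIntegral_le_of_forall_le` — if `‖F‖ ≤ B` on the cube `[0, t]^k` then
  `‖orderedIntegral k F t‖ ≤ B tᵏ` (crude: the simplex has volume `tᵏ/k!`; the factorial is not
  needed at fixed order);
* `tendsto_orderedIntegral_of_dominated` — **dominated (bounded) convergence for ordered
  integrals**: if continuous integrands `F_a` are uniformly bounded on `[0, t]^k` and converge
  pointwise there to a continuous `F` along a countably generated filter, then
  `orderedIntegral k F_a t → orderedIntegral k F t` (induction on `k`, Lebesgue's theorem for
  interval integrals at each step, `intervalIntegral.tendsto_integral_filter_of_dominated_convergence`);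
  the primed version drops the (unnecessary) continuity of the limit integrand.

Everything is PROVED; no definition. [folklore]

## References

* O. Bratteli, D. W. Robinson, *Operator Algebras and Quantum Statistical Mechanics 2*, 2nd ed.
  (1997), §5.4.1 (term-by-term limits in perturbation expansions of KMS states). [BratteliRobinson1997]
-/

noncomputable section

open MeasureTheory Set Filter Topology intervalIntegral
open scoped Interval

namespace Literature.MathematicalPhysics.QuantumLattice

variable {E : Type*} [NormedAddCommGroup E] [NormedSpace ℝ E]

/-- Appending a last coordinate in `[0, t]` to a point of `[0, u]^k`, `u ≤ t`, gives a point of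
`[0, t]^{k+1}`. [folklore] -/
theorem snoc_mem_cube {k : ℕ} {t u : ℝ} (hu : u ∈ Icc 0 t) {w : Fin k → ℝ}
    (hw : ∀ i, w i ∈ Icc 0 u) (i : Fin (k + 1)) : (Fin.snoc w u : Fin (k + 1) → ℝ) i ∈ Icc 0 t := by
  induction i using Fin.lastCases with
  | last => rw [Fin.snoc_last]; exact hu
  | cast j => rw [Fin.snoc_castSucc]; exact ⟨(hw j).1, (hw j).2.trans hu.2⟩

/-- **The crude bound on an ordered integral**: `‖F‖ ≤ B` on `[0, t]^k` (`t, B ≥ 0`) gives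
`‖orderedIntegral k F t‖ ≤ B tᵏ`. [folklore] -/
theorem norm_orderedIntegral_le_of_forall_le :
    ∀ (k : ℕ) (F : (Fin k → ℝ) → E) {t B : ℝ}, 0 ≤ t → 0 ≤ B →
      (∀ w : Fin k → ℝ, (∀ i, w i ∈ Icc 0 t) → ‖F w‖ ≤ B) → ‖orderedIntegral k F t‖ ≤ B * t ^ k
  | 0, F, t, B, _, _, h => by
    rw [orderedIntegral_zero, pow_zero, mul_one]
    exact h _ fun i => i.elim0
  | k + 1, F, t, B, ht, hB, h => by
    rw [orderedIntegral_succ]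
    have hG : ∀ u ∈ Ι (0 : ℝ) t, ‖orderedIntegral k (fun w => F (Fin.snoc w u)) u‖ ≤ B * t ^ k := by
      intro u hu
      rw [uIoc_of_le ht] at hu
      have hu' : u ∈ Icc 0 t := ⟨hu.1.le, hu.2⟩
      refine (norm_orderedIntegral_le_of_forall_le k _ hu.1.le hB fun w hw => h _ (snoc_mem_cube hu' hw)).trans ?_
      exact mul_le_mul_of_nonneg_left (pow_le_pow_left₀ hu.1.le hu.2 k) hB
    calc ‖∫ u in (0 : ℝ)..t, orderedIntegral k (fun w => F (Fin.snoc w u)) u‖ ≤ B * t ^ k * |t - 0| :=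
          intervalIntegral.norm_integral_le_of_norm_le_const hG
      _ = B * t ^ (k + 1) := by rw [sub_zero, abs_of_nonneg ht, pow_succ, mul_assoc]

/-- **Dominated (bounded) convergence for ordered integrals.** Along a countably generated filter
`l`, let `F_a`, `F` be continuous integrands on `ℝ^k` with `‖F_a w‖ ≤ B` for all `a` and all
`w ∈ [0, t]^k` and `F_a w → F w` for every `w ∈ [0, t]^k` (`t ≥ 0`). Then
`orderedIntegral k F_a t → orderedIntegral k F t`. [folklore] -/
theorem tendsto_orderedIntegral_of_dominated {α : Type*} {l : Filter α} [l.IsCountablyGenerated] :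
    ∀ (k : ℕ) (F : α → (Fin k → ℝ) → E) (G : (Fin k → ℝ) → E) {t B : ℝ}, 0 ≤ t → 0 ≤ B →
      (∀ a, Continuous (F a)) → Continuous G →
      (∀ a (w : Fin k → ℝ), (∀ i, w i ∈ Icc 0 t) → ‖F a w‖ ≤ B) →
      (∀ w : Fin k → ℝ, (∀ i, w i ∈ Icc 0 t) → Tendsto (fun a => F a w) l (𝓝 (G w))) →
      Tendsto (fun a => orderedIntegral k (F a) t) l (𝓝 (orderedIntegral k G t))
  | 0, F, G, t, B, _, _, _, _, _, hlim => by
    simp only [orderedIntegral_zero]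
    exact hlim _ fun i => i.elim0
  | k + 1, F, G, t, B, ht, hB, hFc, hGc, hbd, hlim => by
    simp only [orderedIntegral_succ]
    -- the inner ordered integrals as functions of the last time
    have hcont : ∀ a, Continuous fun u : ℝ => orderedIntegral k (fun w => F a (Fin.snoc w u)) u :=
      fun a => continuous_orderedIntegral k (fun (u : ℝ) w => F a (Fin.snoc w u))
        ((hFc a).comp ((continuous_finSnoc k).comp (continuous_snd.prodMk continuous_fst))) id
        continuous_id
    refine intervalIntegral.tendsto_integral_filter_of_dominated_convergence (fun _ => B * t ^ k)
      (Eventually.of_forall fun a => (hcont a).aestronglyMeasurable) ?_ ?_ ?_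
    · refine Eventually.of_forall fun a => ae_of_all _ fun u hu => ?_
      rw [uIoc_of_le ht] at hu
      have hu' : u ∈ Icc 0 t := ⟨hu.1.le, hu.2⟩
      refine (norm_orderedIntegral_le_of_forall_le k _ hu.1.le hB fun w hw =>
        hbd a _ (snoc_mem_cube hu' hw)).trans ?_
      exact mul_le_mul_of_nonneg_left (pow_le_pow_left₀ hu.1.le hu.2 k) hB
    · exact intervalIntegrable_const
    · refine ae_of_all _ fun u hu => ?_
      rw [uIoc_of_le ht] at hu
      have hu' : u ∈ Icc 0 t := ⟨hu.1.le, hu.2⟩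
      exact tendsto_orderedIntegral_of_dominated k (fun a w => F a (Fin.snoc w u)) (fun w => G (Fin.snoc w u))
        hu.1.le hB (fun a => (hFc a).comp ((continuous_finSnoc k).comp (continuous_id.prodMk continuous_const)))
        (hGc.comp ((continuous_finSnoc k).comp (continuous_id.prodMk continuous_const)))
        (fun a w hw => hbd a _ (snoc_mem_cube hu' hw)) (fun w hw => hlim _ (snoc_mem_cube hu' hw))

/-- **Dominated (bounded) convergence for ordered integrals, without continuity of the limit.**
As `tendsto_orderedIntegral_of_dominated`, but the limit integrand `G` need not be continuous
(Lebesgue's theorem does not require measurability of the limit; only the approximants `F_a` are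
assumed continuous). [folklore] -/
theorem tendsto_orderedIntegral_of_dominated' {α : Type*} {l : Filter α} [l.IsCountablyGenerated] :
    ∀ (k : ℕ) (F : α → (Fin k → ℝ) → E) (G : (Fin k → ℝ) → E) {t B : ℝ}, 0 ≤ t → 0 ≤ B →
      (∀ a, Continuous (F a)) →
      (∀ a (w : Fin k → ℝ), (∀ i, w i ∈ Icc 0 t) → ‖F a w‖ ≤ B) →
      (∀ w : Fin k → ℝ, (∀ i, w i ∈ Icc 0 t) → Tendsto (fun a => F a w) l (𝓝 (G w))) →
      Tendsto (fun a => orderedIntegral k (F a) t) l (𝓝 (orderedIntegral k G t))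
  | 0, F, G, t, B, _, _, _, _, hlim => by
    simp only [orderedIntegral_zero]
    exact hlim _ fun i => i.elim0
  | k + 1, F, G, t, B, ht, hB, hFc, hbd, hlim => by
    simp only [orderedIntegral_succ]
    have hcont : ∀ a, Continuous fun u : ℝ => orderedIntegral k (fun w => F a (Fin.snoc w u)) u :=
      fun a => continuous_orderedIntegral k (fun (u : ℝ) w => F a (Fin.snoc w u))
        ((hFc a).comp ((continuous_finSnoc k).comp (continuous_snd.prodMk continuous_fst))) id
        continuous_id
    refine intervalIntegral.tendsto_integral_filter_of_dominated_convergence (fun _ => B * t ^ k)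
      (Eventually.of_forall fun a => (hcont a).aestronglyMeasurable) ?_ ?_ ?_
    · refine Eventually.of_forall fun a => ae_of_all _ fun u hu => ?_
      rw [uIoc_of_le ht] at hu
      have hu' : u ∈ Icc 0 t := ⟨hu.1.le, hu.2⟩
      refine (norm_orderedIntegral_le_of_forall_le k _ hu.1.le hB fun w hw =>
        hbd a _ (snoc_mem_cube hu' hw)).trans ?_
      exact mul_le_mul_of_nonneg_left (pow_le_pow_left₀ hu.1.le hu.2 k) hB
    · exact intervalIntegrable_const
    · refine ae_of_all _ fun u hu => ?_
      rw [uIoc_of_le ht] at hu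
      have hu' : u ∈ Icc 0 t := ⟨hu.1.le, hu.2⟩
      exact tendsto_orderedIntegral_of_dominated' k (fun a w => F a (Fin.snoc w u)) (fun w => G (Fin.snoc w u))
        hu.1.le hB (fun a => (hFc a).comp ((continuous_finSnoc k).comp (continuous_id.prodMk continuous_const)))
        (fun a w hw => hbd a _ (snoc_mem_cube hu' hw)) (fun w hw => hlim _ (snoc_mem_cube hu' hw))

end Literature.MathematicalPhysics.QuantumLattice

end
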